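import Literature.NumberTheory.LFunctions.SonineExtendedMellinContinuation
import Literature.NumberTheory.LFunctions.BurnolScriptL1FourierProofs
import Literature.NumberTheory.LFunctions.BurnolSonineHardyStrip
import Mathlib.Analysis.Complex.PhragmenLindelof
import HarnessLib

/-!
# Burnol 2004b, Thm. 4.8: the functions in `L̂_a` have the L-Property

LINE 1 — LABEL: RH-FREE (growth in vertical strips of the continued right Mellin transforms of the
even `L²` functions that are constant on `(0,a)` together with their cosine transform; the Riemann
zeta function does not occur). FRAMING (cell rh-crit, D-0074): corpus theorems are RH-FREE literature;
nothing here is worded as progress toward RH. bears_on: B-C/B-P (LADDER-RH COLUMN 6, de Branges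
framework) — Thm. 4.8 is the input of [Burnol2004b] Thm. 4.9 (density of `𝓛₁`), Thm. 5.2 / Cor. 5.3
(the residue expansion and the completeness of `ζ(s)/(s−ρ)`). WHAT THIS IS NOT: not a route, not a
criterion; discharging an as-printed structural theorem of an RH-criterion corpus fixes corpus
vocabulary and moves RH by nothing. Nothing here bears on the truth of RH.

Source. J.-F. Burnol, *Two complete and minimal systems associated with the zeros of the Riemann zeta
function*, J. Théor. Nombres Bordeaux **16** (2004) 65–94 = arXiv:math/0203120v7 [Burnol2004b], §4,
Definition of the L-Property and Thm. 4.8 (TeX of record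
`rh-crit/dbl/src/Burnol2004JTNB_arXivmath0203120v7.tex` l.822–884):

> **Definition.** We say that a function `F(s)`, analytic in `ℂ` with at most finitely many poles, has
> the L-Property if the estimates `F(σ+iτ) = O_{a,b,ε}((1+|τ|)^{(1/2−a)⁺+ε})` hold (away from the
> poles), for `−∞ < a ≤ σ ≤ b < ∞`, `ε > 0`.
> **Theorem 4.8.** The functions in `L̂_a` have the L-Property.

Printed proof (TeX l.836–884), for `g ∈ K_a` first: `∫_a^∞ g(t)t^{−s}dt = ∫_a^∞ 𝓕₊(g)(u)·𝓕₊(𝟙_{t>a}t^{−s})(u)du`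
with the series of [Burnol2001CRAS] eq. (1.3) for `𝓕₊(𝟙_{t>a}t^{−s})`, which is `O(|s|/u)` on `u > a`
in the critical strip, "hence: `G(s) = O(|s|)` in `1/4 ≤ Re s ≤ 3/4`. From `|χ(s)| ∼ |Im s/(2π)|^{−Re s+1/2}`
([Titchmarsh1986, IV.12.3]) and from the fact that `G` is `O(A^{Re s})` in `Re s ≥ 1/2+ε` and the
functional equation on the left, "one applies the Phragmén–Lindelöf principle in the strip" (Lindelöf
exponents `≤ 0` for `σ ≥ 1/2`, `≤ 1/2 − σ` for `σ ≤ 1/2`); the extension `K_a → L_a` changes `G` by the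
polar part `c·a^{1−s}/(1−s)` and an entire function of the same type.

## What is PROVED (theorem-only module: no definition, no new named fact; net debt −1)

* `Burnol2004b_thm4_8_holds : Burnol2004b_thm4_8` — the DISCHARGE of the named fact of
  `BurnolZetaSystemsHardy.lean` (`∀ a > 0, ∀ g ∈ L_a, HasLProperty (rightMellinExt g)`).
* Reusable pieces (namespace `BurnolLProperty`), for `g ∈ L_a` (or `g ∈ L²` constant on `(0,a)` with a
  continued transform) and `G_g = rightMellinExt g`:
  `rightMellinExt_eq_polar_add_mellin` (`G_g(s) = c·a^{1−s}/(1−s) + ∫_a^∞ g t^{−s}` on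
  `{Re s > 1/2} ∖ {1}`), `norm_rightMellinExt_le_of_re_gt_half` / `exists_bound_right` (bounded on
  `1/2+η ≤ Re s ≤ b` away from the pole), `rightMellinExt_eq_chi_mul` (`G_g(s) = χ(s)G_{𝓕g}(1−s)` off the
  poles) / `exists_bound_left` (`O(|Im s|^{1/2−σ})` on `a₀ ≤ Re s ≤ 1/2−η`), `exists_bound_strip_of_mem_sonineL`
  (Burnol's a priori bound in the critical strip, here `O(|s|²)`), `exists_bound_middle`
  (`O((1+|Im s|)^η)` on `|Re s − 1/2| ≤ η`), and the kernel bounds `norm_ibpEntire_le_of_re_lt_neg_one`,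
  `norm_ibpEntire_le_of_re_lt_zero`, `norm_cosKernel_le`, `norm_sonineMellinExt_le` for the entire kernels
  `J(λ,a,z)`, `C_a(u,w)` of `BurnolCosineKernelEntire.lean`.

## How the printed proof is followed (tree inputs)

* RIGHT (`Re s ≥ 1/2 + η`): the strip decomposition `f̂(s) = c·a^{1−s}/(1−s) + ∫_a^∞ f t^{−s}`
  (`rightMellin_eq_of_ae_eq_const`, `BurnolSonineHardyStrip.lean`) is continued to the punctured
  half-plane by the identity theorem (`SonineMellin.differentiableOn_mellin` for the tail), and
  `|g|t^{−σ} ≤ (|g|² + t^{−2σ})/2` bounds the tail integral by `(‖g‖² + a^{1−2σ}/(2σ−1))/2`.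
* LEFT (`Re s ≤ 1/2 − η`): Prop. 2.2 (v) for `𝓕g ∈ L_a` (`fourier_mem_sonineL`,
  `SonineLContinuation.rightMellinExt_functionalEquation_of_mem_sonineL`, `𝓕𝓕g = g`) gives
  `G_g(s) = Γ_ℝ(1−s)/Γ_ℝ(s)·G_{𝓕g}(1−s)`; the `χ`-estimate in strips is
  `BurnolScriptL1.exists_norm_Gammaℝ_one_sub_div_le` ([Titchmarsh1986, (4.12.3)], dbl-t4's file).
* A PRIORI in `0 < σ₁ ≤ Re s ≤ σ₂ < 1`: the explicit continuation
  `G_g(s) = c·a^{1−s}/(1−s) + c'(J(2πa,a,−1−s) − J(−2πa,a,−1−s))/(2πi) + ∫_a^∞ 𝓕g(u)C_a(u,1−s)du`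
  (`SonineLContinuation.rightMellinExt_eqOn_explicit`), with the kernels taken at a FIXED level of
  integration by parts (`ibpEntire_eq_integral`, `ibpEntire_eq_ibpLevel_of_re_lt` with `M = 1`):
  `|J(λ,a,z)| ≤ a^{Re z}(1 + |z|/|Re z|)/|λ|` for `Re z < 0`, i.e. `C_a(u,1−s) = O(|s|/u)` — exactly the
  printed `O(|s|/u)`; then `|𝓕g|·K/u ≤ (|𝓕g|² + K²/u²)/2`.
* MIDDLE (`|Re s − 1/2| ≤ η`, `η = min(ε,1/4)`): Mathlib's `PhragmenLindelof.vertical_strip` (bounded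
  version) applied to `F(s) = G_g(s)·(s+1)^{−η}` (real exponent: `|(s+1)^{−η}| = |s+1|^{−η}`,
  holomorphic on `Re s > −1`), whose boundary values are bounded by the RIGHT and LEFT estimates (the
  part `|Im s| ≤ 1` of the left edge by compactness) and whose growth inside is at most polynomial by
  the a priori bound; hence `|G_g(s)| ≤ C|s+1|^{η} ≤ 2C(1+|Im s|)^{η}` — Lindelöf's theorem in the form
  of [Titchmarsh1939, §5.65].
* ASSEMBLY: on `[a',b'] × {|τ| ≥ 1}` the three regimes give exponents `0`, `1/2 − σ ≤ 1/2 − a'`, `η ≤ ε`,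
  all `≤ max(1/2−a',0) + ε`.

DEVIATIONS FROM PRINT (declared, immaterial): (i) the a priori bound is proved as `O(|s|²)` (AM–GM in
`u` instead of Cauchy–Schwarz), any polynomial bound being enough for Phragmén–Lindelöf; (ii) on
`Re s ≥ 1/2 + η` we prove `O_η(1)` on bounded strips directly by AM–GM rather than quote `ℍ²`
(`O(A^{Re s})` and `O(1)` agree on `σ ≤ b`); (iii) the case `g ∈ K_a` is not treated separately — the
explicit continuation of Prop. 2.2 (dbl-t14, `SonineExtendedMellinContinuation.lean`) already covers
`L_a`.

## References
* [Burnol2004b] J.-F. Burnol, JTNB 16 (2004) = arXiv:math/0203120v7, §4 Def. of the L-Property and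
  Thm. 4.8 (p. 9–10, TeX l.822–884), Prop. 2.2 (p. 5, TeX l.460–469).
* [Burnol2001CRAS] J.-F. Burnol, CRAS 333 (2001) = arXiv:math/0105120, eq. (1.2)–(1.3), Lemmes 1.2–1.3
  (TeX l.320–367).
* [Titchmarsh1986] E. C. Titchmarsh, *The Theory of the Riemann Zeta-Function*, 2nd ed., OUP 1986,
  §4.12 eq. (4.12.3).
* [Titchmarsh1939] E. C. Titchmarsh, *The Theory of Functions*, 2nd ed., OUP 1939, §5.65 (Lindelöf's
  theorem via Phragmén–Lindelöf).
-/

noncomputable section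

open MeasureTheory Complex Filter Set Asymptotics
open scoped Real Topology FourierTransform

namespace Literature.NumberTheory.LFunctions

namespace BurnolLProperty

open Literature.Analysis.DeBrangesSpaces.SonineMellin

/-! ### A. Crude growth of the CRAS kernels in vertical strips (one integration by parts) -/

/-- `|e^{iλt}| = 1` for real `λ, t`. [folklore] -/
private theorem norm_cexp_I_mul (l t : ℝ) : ‖cexp (I * l * t)‖ = 1 := by
  rw [show (I * l * t : ℂ) = ((l * t : ℝ) : ℂ) * I by push_cast; ring]
  exact Complex.norm_exp_ofReal_mul_I _

/-- `‖∫_a^∞ e^{iλt} t^z dt‖ ≤ a^{Re z + 1}/(−(Re z + 1))` for `Re z < −1`, `a > 0`. [folklore] -/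
private theorem norm_integral_cexp_mul_cpow_le {a : ℝ} (ha : 0 < a) (l : ℝ) {z : ℂ} (hz : z.re < -1) :
    ‖∫ t in Ioi a, cexp (I * l * t) * (t : ℂ) ^ z‖ ≤ a ^ (z.re + 1) / (-(z.re + 1)) := by
  calc ‖∫ t in Ioi a, cexp (I * l * t) * (t : ℂ) ^ z‖
      ≤ ∫ t in Ioi a, t ^ z.re := by
        refine norm_integral_le_of_norm_le (integrableOn_Ioi_rpow_of_lt hz ha) ?_
        refine (ae_restrict_mem measurableSet_Ioi).mono fun t ht ↦ ?_
        rw [norm_mul, norm_cexp_I_mul, one_mul, norm_cpow_eq_rpow_re_of_pos (ha.trans ht)]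
    _ = -a ^ (z.re + 1) / (z.re + 1) := integral_Ioi_rpow_of_lt hz ha
    _ = a ^ (z.re + 1) / (-(z.re + 1)) := by rw [neg_div, div_neg]

/-- Level-0 bound: `‖J(λ,a,z)‖ ≤ a^{Re z+1}/(−(Re z+1))` for `Re z < −1` (the kernel IS the absolutely
convergent integral there). [cite: Burnol2001CRAS, Lemme 1.2 and eq. (1.2) (TeX l.320–355)] -/
theorem norm_ibpEntire_le_of_re_lt_neg_one {l a : ℝ} (hl : l ≠ 0) (ha : 0 < a) {z : ℂ}
    (hz : z.re < -1) : ‖ibpEntire l a z‖ ≤ a ^ (z.re + 1) / (-(z.re + 1)) := by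
  rw [ibpEntire_eq_integral hl ha hz]
  exact norm_integral_cexp_mul_cpow_le ha l hz

/-- Level-1 bound: `‖J(λ,a,z)‖ ≤ (a^{Re z}/|λ|)·(1 + ‖z‖/(−Re z))` for `Re z < 0` (one integration by
parts: boundary term `a^{Re z}/|λ|`, coefficient `|z|/|λ|`, tail `∫_a^∞ t^{Re z − 1} = a^{Re z}/(−Re z)`).
This is the `O(|s|/u)` behind Burnol's "`G(s) = O(|s|)` on `1/4 ≤ Re s ≤ 3/4`".
[cite: Burnol2001CRAS, Lemme 1.3 (TeX l.358–367); Burnol2004b, proof of Thm. 4.8 (TeX l.851–856)] -/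
theorem norm_ibpEntire_le_of_re_lt_zero {l a : ℝ} (hl : l ≠ 0) (ha : 0 < a) {z : ℂ}
    (hz : z.re < 0) : ‖ibpEntire l a z‖ ≤ a ^ z.re / |l| * (1 + ‖z‖ / (-z.re)) := by
  have hl' : 0 < |l| := abs_pos.mpr hl
  have hIl : ‖(I * l : ℂ)‖ = |l| := by
    rw [norm_mul, norm_I, one_mul, Complex.norm_real, Real.norm_eq_abs]
  rw [ibpEntire_eq_ibpLevel_of_re_lt hl ha (M := 1) (by push_cast; linarith)]
  -- unfold the level-1 formula
  have hlev : ibpLevel l a 1 z =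
      ibpBoundary l a z + (-(z / (I * l))) * ∫ t in Ioi a, cexp (I * l * t) * (t : ℂ) ^ (z - 1) := by
    simp only [ibpLevel, Finset.sum_range_one, ibpCoef_zero, ibpCoef_succ, Nat.cast_zero, sub_zero,
      one_mul, ibpTail, Nat.cast_one, neg_div]
  rw [hlev]
  have hz1 : (z - 1).re < -1 := by simp; linarith
  have htail := norm_integral_cexp_mul_cpow_le ha l hz1
  have hre : (z - 1).re + 1 = z.re := by simp
  rw [hre] at htail
  calc ‖ibpBoundary l a z + -(z / (I * ↑l)) * ∫ t in Ioi a, cexp (I * ↑l * ↑t) * (t : ℂ) ^ (z - 1)‖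
      ≤ ‖ibpBoundary l a z‖ + ‖-(z / (I * ↑l))‖ * ‖∫ t in Ioi a, cexp (I * ↑l * ↑t) * (t : ℂ) ^ (z - 1)‖ := by
        rw [← norm_mul]; exact norm_add_le _ _
    _ ≤ a ^ z.re / |l| + ‖z‖ / |l| * (a ^ z.re / (-z.re)) := by
        rw [norm_ibpBoundary l ha, norm_neg, norm_div, hIl]
        gcongr
    _ = a ^ z.re / |l| * (1 + ‖z‖ / (-z.re)) := by
        field_simp

/-- The cosine kernel in a vertical strip: `‖C_a(u,w)‖ ≤ a^{Re w−1}(1 + ‖w−1‖/(1−Re w))/(π|u|)` for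
`Re w < 1`, `u ≠ 0`. [cite: Burnol2001CRAS, Lemme 1.3 (TeX l.358–367)] -/
theorem norm_cosKernel_le {a u : ℝ} (ha : 0 < a) (hu : u ≠ 0) {w : ℂ} (hw : w.re < 1) :
    ‖cosKernel a u w‖ ≤ a ^ (w.re - 1) * (1 + ‖w - 1‖ / (1 - w.re)) / (π * |u|) := by
  have hz : (w - 1).re < 0 := by simp; linarith
  have hl : (2 * π * u : ℝ) ≠ 0 := by positivity
  have hl' : (-(2 * π * u) : ℝ) ≠ 0 := neg_ne_zero.mpr hl
  have h1 := norm_ibpEntire_le_of_re_lt_zero hl ha hz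
  have h2 := norm_ibpEntire_le_of_re_lt_zero hl' ha hz
  have habs : |2 * π * u| = 2 * π * |u| := by
    rw [abs_mul, abs_of_pos (by positivity : (0 : ℝ) < 2 * π)]
  rw [abs_neg, habs] at h2
  rw [habs] at h1
  have hre : (w - 1).re = w.re - 1 := by simp
  have hre' : -(w.re - 1) = 1 - w.re := by ring
  rw [hre, hre'] at h1 h2
  calc ‖cosKernel a u w‖ ≤ ‖ibpEntire (2 * π * u) a (w - 1)‖ + ‖ibpEntire (-(2 * π * u)) a (w - 1)‖ :=
        norm_add_le _ _
    _ ≤ a ^ (w.re - 1) / (2 * π * |u|) * (1 + ‖w - 1‖ / (1 - w.re)) +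
        a ^ (w.re - 1) / (2 * π * |u|) * (1 + ‖w - 1‖ / (1 - w.re)) := add_le_add h1 h2
    _ = a ^ (w.re - 1) * (1 + ‖w - 1‖ / (1 - w.re)) / (π * |u|) := by
        have hπ : (π : ℝ) ≠ 0 := Real.pi_ne_zero
        have hu' : |u| ≠ 0 := abs_ne_zero.mpr hu
        field_simp
        ring

/-- AM–GM against a kernel bounded by `K/u` on `(a,∞)`: `‖∫_a^∞ F(u)C_a(u,w)du‖ ≤ (∫‖F‖² + K²/a)/2`.
[cite: Burnol2001CRAS, Lemme 1.3 and eq. (1.2) (TeX l.326–367)] -/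
theorem norm_sonineMellinExt_le {a : ℝ} (ha : 0 < a) (F : Lp ℂ 2 (volume : Measure ℝ)) {w : ℂ}
    {K : ℝ} (hC : ∀ u : ℝ, a < u → ‖cosKernel a u w‖ ≤ K / u) :
    ‖sonineMellinExt a a F w‖ ≤ ((∫ u, ‖(F : ℝ → ℂ) u‖ ^ 2) + K ^ 2 * a⁻¹) / 2 := by
  have hsq : Integrable (fun u : ℝ ↦ ‖(F : ℝ → ℂ) u‖ ^ 2) :=
    (memLp_two_iff_integrable_sq_norm (Lp.memLp F).1).1 (Lp.memLp F)
  have hpow : IntegrableOn (fun u : ℝ ↦ u ^ (-2 : ℝ)) (Ioi a) :=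
    integrableOn_Ioi_rpow_of_lt (by norm_num) ha
  have hmaj : IntegrableOn (fun u : ℝ ↦ (‖(F : ℝ → ℂ) u‖ ^ 2 + K ^ 2 * u ^ (-2 : ℝ)) / 2) (Ioi a) :=
    (hsq.integrableOn.add (hpow.const_mul _)).div_const _
  have hbd : ∀ᵐ u ∂(volume.restrict (Ioi a)),
      ‖(F : ℝ → ℂ) u * cosKernel a u w‖ ≤ (‖(F : ℝ → ℂ) u‖ ^ 2 + K ^ 2 * u ^ (-2 : ℝ)) / 2 := by
    filter_upwards [ae_restrict_mem measurableSet_Ioi] with u hu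
    have hu0 : 0 < u := ha.trans hu
    have h1 : ‖(F : ℝ → ℂ) u * cosKernel a u w‖ ≤ ‖(F : ℝ → ℂ) u‖ * (K / u) := by
      rw [norm_mul]
      exact mul_le_mul_of_nonneg_left (hC u hu) (norm_nonneg _)
    have h2 : 2 * ‖(F : ℝ → ℂ) u‖ * (K / u) ≤ ‖(F : ℝ → ℂ) u‖ ^ 2 + (K / u) ^ 2 :=
      two_mul_le_add_sq _ _
    have h3 : (K / u) ^ 2 = K ^ 2 * u ^ (-2 : ℝ) := by
      rw [Real.rpow_neg hu0.le, show (2 : ℝ) = ((2 : ℕ) : ℝ) by norm_num, Real.rpow_natCast]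
      field_simp
    rw [← h3]
    linarith
  calc ‖sonineMellinExt a a F w‖
      ≤ ∫ u in Ioi a, (‖(F : ℝ → ℂ) u‖ ^ 2 + K ^ 2 * u ^ (-2 : ℝ)) / 2 :=
        norm_integral_le_of_norm_le hmaj hbd
    _ = ((∫ u in Ioi a, ‖(F : ℝ → ℂ) u‖ ^ 2) + K ^ 2 * ∫ u in Ioi a, u ^ (-2 : ℝ)) / 2 := by
        rw [integral_div, integral_add hsq.integrableOn (hpow.const_mul _), integral_const_mul]
    _ ≤ ((∫ u, ‖(F : ℝ → ℂ) u‖ ^ 2) + K ^ 2 * a⁻¹) / 2 := by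
        have hI : ∫ u in Ioi a, u ^ (-2 : ℝ) = a⁻¹ := by
          rw [integral_Ioi_rpow_of_lt (by norm_num) ha, show (-2 : ℝ) + 1 = -1 by norm_num,
            Real.rpow_neg_one]
          field_simp
        rw [hI]
        have hle : ∫ u in Ioi a, ‖(F : ℝ → ℂ) u‖ ^ 2 ≤ ∫ u, ‖(F : ℝ → ℂ) u‖ ^ 2 :=
          setIntegral_le_integral hsq (Eventually.of_forall fun u ↦ by positivity)
        linarith

/-- `a^x ≤ a^{x₁} + a^{x₂}` for `x₁ ≤ x ≤ x₂`, `a > 0` (monotone one way or the other). [folklore] -/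
private theorem rpow_le_rpow_add_rpow {a : ℝ} (ha : 0 < a) {x x₁ x₂ : ℝ} (h₁ : x₁ ≤ x) (h₂ : x ≤ x₂) :
    a ^ x ≤ a ^ x₁ + a ^ x₂ := by
  have p1 : 0 < a ^ x₁ := Real.rpow_pos_of_pos ha _
  have p2 : 0 < a ^ x₂ := Real.rpow_pos_of_pos ha _
  rcases le_or_gt 1 a with h | h
  · have := Real.rpow_le_rpow_of_exponent_le h h₂
    linarith
  · have := Real.rpow_le_rpow_of_exponent_ge ha h.le h₁
    linarith

/-- An even a.e.-statement on `(0,a)` transfers to `(−a,a)`. [folklore] -/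
private theorem ae_const_Ioo_of_even {g : ℝ → ℂ} {a : ℝ} {c : ℂ} (heven : ∀ᵐ x : ℝ, g (-x) = g x)
    (hc : ∀ᵐ x : ℝ, x ∈ Ioo 0 a → g x = c) : ∀ᵐ x : ℝ, x ∈ Ioo (-a) a → g x = c := by
  have hneg : ∀ᵐ x : ℝ, -x ∈ Ioo 0 a → g (-x) = c :=
    (Measure.measurePreserving_neg (volume : Measure ℝ)).quasiMeasurePreserving.ae hc
  have hne : ∀ᵐ x : ℝ, x ≠ 0 := by
    have : (volume : Measure ℝ) {0} = 0 := measure_singleton 0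
    filter_upwards [measure_eq_zero_iff_ae_notMem.1 this] with u hu
    simpa using hu
  filter_upwards [hc, hneg, heven, hne] with x h1 h2 h3 h4 hx
  rcases lt_or_gt_of_ne h4 with hlt | hgt
  · rw [← h3]
    exact h2 ⟨by linarith [hx.1], by linarith [hx.1]⟩
  · exact h1 ⟨hgt, hx.2⟩

/-- **Burnol's a priori bound "`G(s) = O(|s|)` in the strip" (here `O(|s|²)`, which is all the
Phragmén–Lindelöf step needs)**: for `g ∈ L_a` and `0 < σ₁ ≤ Re s ≤ σ₂ < 1`,
`‖G_g(s)‖ ≤ M·(1+‖s‖)²`, read off the explicit continuation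
`G_g(s) = c·a^{1−s}/(1−s) + c'·(J(2πa,a,−1−s) − J(−2πa,a,−1−s))/(2πi) + ∫_a^∞ 𝓕g(u)C_a(u,1−s)du`
(`SonineLContinuation.rightMellinExt_eqOn_explicit`) and the one-integration-by-parts kernel bounds.
[cite: Burnol2004b, proof of Thm. 4.8 (arXiv:math/0203120v7 p. 10, TeX l.851–856)] -/
theorem exists_bound_strip_of_mem_sonineL {a : ℝ} (ha : 0 < a) {g : Lp ℂ 2 (volume : Measure ℝ)}
    (hg : g ∈ sonineL a) {σ₁ σ₂ : ℝ} (hσ₁ : 0 < σ₁) (hσ₂ : σ₂ < 1) :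
    ∃ M : ℝ, 0 ≤ M ∧ ∀ s : ℂ, σ₁ ≤ s.re → s.re ≤ σ₂ →
      ‖rightMellinExt g s‖ ≤ M * (1 + ‖s‖) ^ 2 := by
  obtain ⟨heven, ⟨c, hc⟩, ⟨c', hc'⟩⟩ := hg
  have hfc := ae_const_Ioo_of_even heven hc
  have hFc := ae_const_Ioo_of_even (fourierL2_even heven) hc'
  set F : Lp ℂ 2 (volume : Measure ℝ) := 𝓕 g with hFdef
  set G : ℂ → ℂ := fun s ↦ c * (a : ℂ) ^ (1 - s) / (1 - s) +
    c' * ((ibpEntire (2 * π * a) a (1 - s - 2) - ibpEntire (-(2 * π * a)) a (1 - s - 2)) /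
      (2 * π * I)) +
    sonineMellinExt a a ((𝓕 g : Lp ℂ 2 (volume : Measure ℝ)) : ℝ → ℂ) (1 - s) with hGdef
  -- the constants
  set P : ℝ := a ^ (-σ₂) + a ^ (-σ₁) with hP
  set P₁ : ℝ := a ^ (1 - σ₂) + a ^ (1 - σ₁) with hP₁
  set IF : ℝ := ∫ u, ‖(F : ℝ → ℂ) u‖ ^ 2 with hIF
  have hP0 : 0 ≤ P := by positivity
  have hP₁0 : 0 ≤ P₁ := by positivity
  have hIF0 : 0 ≤ IF := integral_nonneg fun u ↦ by positivity
  have h1σ₂ : 0 < 1 - σ₂ := by linarith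
  set M : ℝ := ‖c‖ * P₁ / (1 - σ₂) + ‖c'‖ * (P / σ₁ / π) +
    (IF + (P / (σ₁ * π)) ^ 2 * a⁻¹) / 2 with hM
  refine ⟨M, by positivity, fun s hs₁ hs₂ ↦ ?_⟩
  have hσ : 0 < s.re := hσ₁.trans_le hs₁
  have hs1 : s ∈ {s : ℂ | s ≠ 1} := by
    intro h
    rw [h, one_re] at hs₂
    linarith
  rw [SonineLContinuation.rightMellinExt_eqOn_explicit ha g heven hfc hFc hGdef hs1, hGdef]
  dsimp only
  have h1s : 1 ≤ 1 + ‖s‖ := by linarith [norm_nonneg s]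
  have hsq : 1 ≤ (1 + ‖s‖) ^ 2 := one_le_pow₀ h1s
  -- piece 1: the polar part
  have hpc : ‖c * (a : ℂ) ^ (1 - s) / (1 - s)‖ ≤ ‖c‖ * P₁ / (1 - σ₂) := by
    have hn1 : 1 - σ₂ ≤ ‖1 - s‖ := by
      calc 1 - σ₂ ≤ 1 - s.re := by linarith
        _ = |(1 - s).re| := by rw [sub_re, one_re, abs_of_pos (by linarith)]
        _ ≤ ‖1 - s‖ := Complex.abs_re_le_norm _
    have hapow : ‖(a : ℂ) ^ (1 - s)‖ ≤ P₁ := by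
      rw [norm_cpow_eq_rpow_re_of_pos ha, sub_re, one_re]
      exact rpow_le_rpow_add_rpow ha (by linarith) (by linarith)
    rw [norm_div, norm_mul]
    calc ‖c‖ * ‖(a : ℂ) ^ (1 - s)‖ / ‖1 - s‖ ≤ ‖c‖ * P₁ / ‖1 - s‖ := by gcongr
      _ ≤ ‖c‖ * P₁ / (1 - σ₂) := by
          apply div_le_div_of_nonneg_left (by positivity) h1σ₂ hn1
  -- piece 2: the contribution of the constant `c'`
  have hz : (1 - s - 2 : ℂ).re < -1 := by simp; linarith
  have hzre : (1 - s - 2 : ℂ).re + 1 = -s.re := by simp; ring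
  have hJ : ∀ l : ℝ, l ≠ 0 → ‖ibpEntire l a (1 - s - 2)‖ ≤ P / σ₁ := by
    intro l hl
    have h := norm_ibpEntire_le_of_re_lt_neg_one hl ha hz
    rw [hzre, neg_neg] at h
    calc ‖ibpEntire l a (1 - s - 2)‖ ≤ a ^ (-s.re) / s.re := h
      _ ≤ P / σ₁ := by
          apply div_le_div₀ hP0 (rpow_le_rpow_add_rpow ha (by linarith) (by linarith)) hσ₁ hs₁
  have hl : (2 * π * a : ℝ) ≠ 0 := by positivity
  have hpc' : ‖c' * ((ibpEntire (2 * π * a) a (1 - s - 2) -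
      ibpEntire (-(2 * π * a)) a (1 - s - 2)) / (2 * π * I))‖ ≤ ‖c'‖ * (P / σ₁ / π) := by
    rw [norm_mul]
    gcongr
    rw [norm_div, show ‖(2 * π * I : ℂ)‖ = 2 * π by
      rw [norm_mul, norm_I, mul_one, show (2 * (π : ℂ)) = ((2 * π : ℝ) : ℂ) by push_cast; ring,
        Complex.norm_real, Real.norm_eq_abs, abs_of_pos (by positivity)]]
    calc ‖ibpEntire (2 * π * a) a (1 - s - 2) - ibpEntire (-(2 * π * a)) a (1 - s - 2)‖ / (2 * π)
        ≤ (P / σ₁ + P / σ₁) / (2 * π) := by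
          gcongr
          exact (norm_sub_le _ _).trans (add_le_add (hJ _ hl) (hJ _ (neg_ne_zero.mpr hl)))
      _ = P / σ₁ / π := by field_simp; ring
  -- piece 3: the kernel integral
  have hCK : ∀ u : ℝ, a < u → ‖cosKernel a u (1 - s)‖ ≤ P / (σ₁ * π) * (1 + ‖s‖) / u := by
    intro u hu
    have hu0 : 0 < u := ha.trans hu
    have h := norm_cosKernel_le ha hu0.ne' (w := 1 - s) (by simp; linarith)
    have e1 : (1 - s : ℂ).re - 1 = -s.re := by simp
    have e2 : (1 : ℂ) - s - 1 = -s := by ring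
    have e3 : 1 - (1 - s : ℂ).re = s.re := by simp
    rw [e1, e2, e3, norm_neg, abs_of_pos hu0] at h
    calc ‖cosKernel a u (1 - s)‖ ≤ a ^ (-s.re) * (1 + ‖s‖ / s.re) / (π * u) := h
      _ ≤ P * ((1 + ‖s‖) / σ₁) / (π * u) := by
          gcongr
          · exact rpow_le_rpow_add_rpow ha (by linarith) (by linarith)
          · -- `1 + ‖s‖/σ ≤ (1+‖s‖)/σ₁` as `σ₁ ≤ σ`, `σ₁ ≤ 1`
            rw [le_div_iff₀ hσ₁]
            have : ‖s‖ / s.re * σ₁ ≤ ‖s‖ := by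
              rw [div_mul_eq_mul_div, div_le_iff₀ hσ]
              exact mul_le_mul_of_nonneg_left hs₁ (norm_nonneg _)
            nlinarith [norm_nonneg s]
      _ = P / (σ₁ * π) * (1 + ‖s‖) / u := by field_simp
  have hS := norm_sonineMellinExt_le ha F hCK
  -- assemble
  calc ‖c * (a : ℂ) ^ (1 - s) / (1 - s) +
        c' * ((ibpEntire (2 * π * a) a (1 - s - 2) - ibpEntire (-(2 * π * a)) a (1 - s - 2)) /
          (2 * π * I)) +
        sonineMellinExt a a ((𝓕 g : Lp ℂ 2 (volume : Measure ℝ)) : ℝ → ℂ) (1 - s)‖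
      ≤ ‖c * (a : ℂ) ^ (1 - s) / (1 - s)‖ +
        ‖c' * ((ibpEntire (2 * π * a) a (1 - s - 2) - ibpEntire (-(2 * π * a)) a (1 - s - 2)) /
          (2 * π * I))‖ +
        ‖sonineMellinExt a a ((𝓕 g : Lp ℂ 2 (volume : Measure ℝ)) : ℝ → ℂ) (1 - s)‖ :=
        norm_add₃_le
    _ ≤ ‖c‖ * P₁ / (1 - σ₂) + ‖c'‖ * (P / σ₁ / π) +
        (IF + (P / (σ₁ * π) * (1 + ‖s‖)) ^ 2 * a⁻¹) / 2 := add_le_add_three hpc hpc' hS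
    _ ≤ (‖c‖ * P₁ / (1 - σ₂)) * (1 + ‖s‖) ^ 2 + (‖c'‖ * (P / σ₁ / π)) * (1 + ‖s‖) ^ 2 +
        ((IF + (P / (σ₁ * π)) ^ 2 * a⁻¹) / 2) * (1 + ‖s‖) ^ 2 := by
        have t1 : ‖c‖ * P₁ / (1 - σ₂) ≤ (‖c‖ * P₁ / (1 - σ₂)) * (1 + ‖s‖) ^ 2 :=
          le_mul_of_one_le_right (by positivity) hsq
        have t2 : ‖c'‖ * (P / σ₁ / π) ≤ (‖c'‖ * (P / σ₁ / π)) * (1 + ‖s‖) ^ 2 :=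
          le_mul_of_one_le_right (by positivity) hsq
        have t3 : (IF + (P / (σ₁ * π) * (1 + ‖s‖)) ^ 2 * a⁻¹) / 2 ≤
            ((IF + (P / (σ₁ * π)) ^ 2 * a⁻¹) / 2) * (1 + ‖s‖) ^ 2 := by
          have : IF ≤ IF * (1 + ‖s‖) ^ 2 := le_mul_of_one_le_right hIF0 hsq
          have ha' : 0 ≤ a⁻¹ := by positivity
          nlinarith [mul_nonneg (sq_nonneg (P / (σ₁ * π))) ha']
        linarith
    _ = M * (1 + ‖s‖) ^ 2 := by rw [hM]; ring

/-! ### B. The right half-plane `Re s > 1/2`: `G_g(s) = c·a^{1−s}/(1−s) + ∫_a^∞ g(t)t^{−s}dt` -/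

/-- The punctured half-plane `{Re s > 1/2} ∖ {1}` is preconnected (union of the convex pieces
`1/2 < Re s < 1`, `Im s > 0`, `Re s > 1`, `Im s < 0`, consecutive ones overlapping).
(Private copy of the lemma of `BurnolSonineHardyStrip.lean`.) [folklore] -/
private theorem isPreconnected_halfPlane_diff_one :
    IsPreconnected ({s : ℂ | 1 / 2 < s.re} \ {1}) := by
  set A : Set ℂ := {s | 1 / 2 < s.re} ∩ {s | s.re < 1} with hA
  set B : Set ℂ := {s | 1 / 2 < s.re} ∩ {s | 0 < s.im} with hB
  set C : Set ℂ := {s | 1 < s.re} with hC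
  set D : Set ℂ := {s | 1 / 2 < s.re} ∩ {s | s.im < 0} with hD
  have hAc : IsPreconnected A :=
    ((convex_halfSpace_re_gt (1 / 2)).inter (convex_halfSpace_re_lt 1)).isPreconnected
  have hBc : IsPreconnected B :=
    ((convex_halfSpace_re_gt (1 / 2)).inter (convex_halfSpace_im_gt 0)).isPreconnected
  have hCc : IsPreconnected C := (convex_halfSpace_re_gt 1).isPreconnected
  have hDc : IsPreconnected D :=
    ((convex_halfSpace_re_gt (1 / 2)).inter (convex_halfSpace_im_lt 0)).isPreconnected
  have hAB : IsPreconnected (A ∪ B) :=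
    IsPreconnected.union (Complex.mk (3 / 4) 1) ⟨by norm_num [hA], by norm_num [hA]⟩
      ⟨by norm_num [hB], by norm_num [hB]⟩ hAc hBc
  have hABC : IsPreconnected (A ∪ B ∪ C) :=
    IsPreconnected.union (Complex.mk 2 1) (Or.inr ⟨by norm_num [hB], by norm_num [hB]⟩)
      (by norm_num [hC]) hAB hCc
  have hABCD : IsPreconnected (A ∪ B ∪ C ∪ D) :=
    IsPreconnected.union (Complex.mk 2 (-1)) (Or.inr (by norm_num [hC]))
      ⟨by norm_num [hD], by norm_num [hD]⟩ hABC hDc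
  have heq : ({s : ℂ | 1 / 2 < s.re} \ {1}) = A ∪ B ∪ C ∪ D := by
    ext s
    simp only [Set.mem_sdiff, mem_setOf_eq, mem_singleton_iff, mem_union, mem_inter_iff, hA, hB, hC,
      hD]
    constructor
    · rintro ⟨h1, h2⟩
      rcases lt_trichotomy s.im 0 with him | him | him
      · exact Or.inr ⟨h1, him⟩
      · rcases lt_trichotomy s.re 1 with hre | hre | hre
        · exact Or.inl (Or.inl (Or.inl ⟨h1, hre⟩))
        · exact absurd (Complex.ext (by simp [hre]) (by simp [him])) h2
        · exact Or.inl (Or.inr hre)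
      · exact Or.inl (Or.inl (Or.inr ⟨h1, him⟩))
    · rintro (((⟨h1, hre⟩ | ⟨h1, him⟩) | hre) | ⟨h1, him⟩)
      · exact ⟨h1, fun h ↦ by rw [h, one_re] at hre; exact lt_irrefl _ hre⟩
      · exact ⟨h1, fun h ↦ by rw [h, one_im] at him; exact lt_irrefl _ him⟩
      · refine ⟨?_, fun h ↦ by rw [h, one_re] at hre; exact lt_irrefl _ hre⟩
        show (1 : ℝ) / 2 < s.re
        linarith
      · exact ⟨h1, fun h ↦ by rw [h, one_im] at him; exact lt_irrefl _ him⟩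
  rw [heq]
  exact hABCD

/-- Holomorphy of `w ↦ ∫_0^∞ 𝟙_{t>a}g(t)t^{w−1}dt` on `Re w < 1/2` for `g ∈ L²(ℝ)`, `a > 0`
(Burnol 2001 CRAS §1, the tree's `SonineMellin.differentiableOn_mellin`).
[cite: Burnol2001CRAS, §1 (TeX l.288–290)] -/
theorem differentiableOn_mellin_indicator {a : ℝ} (ha : 0 < a) (g : Lp ℂ 2 (volume : Measure ℝ)) :
    DifferentiableOn ℂ (mellin ((Ioi a).indicator (g : ℝ → ℂ))) {w | w.re < 1 / 2} := by
  have hgm : MemLp ((Ioi a).indicator (g : ℝ → ℂ)) 2 (volume : Measure ℝ) :=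
    (Lp.memLp g).indicator measurableSet_Ioi
  set gL : Lp ℂ 2 (volume : Measure ℝ) := hgm.toLp _ with hgL
  have hcoe : (gL : ℝ → ℂ) =ᵐ[volume] (Ioi a).indicator (g : ℝ → ℂ) := hgm.coeFn_toLp
  have hga : ∀ᵐ x : ℝ, x ∈ Icc (-a) a → (gL : ℝ → ℂ) x = 0 := by
    filter_upwards [hcoe] with x hx hxI
    rw [hx, indicator_of_notMem (show x ∉ Ioi a from not_lt.2 hxI.2)]
  have hD := Literature.Analysis.DeBrangesSpaces.SonineMellin.differentiableOn_mellin ha gL hga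
  have heq : mellin (gL : ℝ → ℂ) = mellin ((Ioi a).indicator (g : ℝ → ℂ)) := by
    funext w
    simp only [mellin]
    refine integral_congr_ae ?_
    filter_upwards [ae_restrict_of_ae (s := Ioi (0 : ℝ)) hcoe] with t ht
    rw [ht]
  rwa [heq] at hD

/-- **The decomposition on the whole punctured half-plane** (identity theorem from the strip): for
`g ∈ L²(ℝ)` with `g = c` a.e. on `(0,a)` whose right Mellin transform has a continuation, and
`Re s > 1/2`, `s ≠ 1`: `G_g(s) = c·a^{1−s}/(1−s) + ∫_a^∞ g(t)t^{−s}dt` ("the right Mellin transform is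
an isometric identification of `ℂ·𝟙_{0<t<a} + L²(a,∞)` with `(s/(s−1))A^s ℍ²`", TeX l.638–643).
[cite: Burnol2004b, §4 before Prop. 4.1 (arXiv:math/0203120v7 p. 7, TeX l.632–643)] -/
theorem rightMellinExt_eq_polar_add_mellin {a : ℝ} (ha : 0 < a) {g : Lp ℂ 2 (volume : Measure ℝ)}
    {c : ℂ} (hgc : ∀ᵐ x : ℝ, x ∈ Ioo 0 a → g x = c) (hex : ∃ G, HasRightMellinContinuation g G)
    {s : ℂ} (hs : 1 / 2 < s.re) (hs1 : s ≠ 1) :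
    rightMellinExt g s =
      c * (a : ℂ) ^ (1 - s) / (1 - s) + mellin ((Ioi a).indicator (g : ℝ → ℂ)) (1 - s) := by
  set U : Set ℂ := {s : ℂ | 1 / 2 < s.re} \ {1} with hU
  have hUo : IsOpen U := (isOpen_lt continuous_const Complex.continuous_re).sdiff isClosed_singleton
  have hG := hasRightMellinContinuation_rightMellinExt hex
  have hGa : AnalyticOnNhd ℂ (rightMellinExt g) U :=
    (hG.1.mono fun z hz ↦ hz.2).analyticOnNhd hUo
  have hΦ : DifferentiableOn ℂ (fun s : ℂ ↦
      c * (a : ℂ) ^ (1 - s) / (1 - s) + mellin ((Ioi a).indicator (g : ℝ → ℂ)) (1 - s)) U := by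
    refine DifferentiableOn.add ?_ ?_
    · refine DifferentiableOn.div ?_ ?_ ?_
      · exact ((differentiable_id.const_sub (1 : ℂ)).const_cpow
          (Or.inl (ofReal_ne_zero.2 ha.ne'))).differentiableOn.const_mul c
      · exact (differentiable_id.const_sub (1 : ℂ)).differentiableOn
      · intro z hz; exact sub_ne_zero.2 (Ne.symm hz.2)
    · refine (differentiableOn_mellin_indicator ha g).comp
        (differentiable_id.const_sub (1 : ℂ)).differentiableOn fun z hz ↦ ?_
      simp only [mem_setOf_eq, sub_re, one_re]
      have : 1 / 2 < z.re := hz.1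
      linarith
  have hΦa : AnalyticOnNhd ℂ (fun s : ℂ ↦
      c * (a : ℂ) ^ (1 - s) / (1 - s) + mellin ((Ioi a).indicator (g : ℝ → ℂ)) (1 - s)) U :=
    hΦ.analyticOnNhd hUo
  have hstrip : IsOpen {s : ℂ | 1 / 2 < s.re ∧ s.re < 1} :=
    (isOpen_lt continuous_const Complex.continuous_re).inter
      (isOpen_lt Complex.continuous_re continuous_const)
  have hmem : (Complex.mk (3 / 4) 0) ∈ {s : ℂ | 1 / 2 < s.re ∧ s.re < 1} := by
    simp only [mem_setOf_eq]; norm_num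
  have hz0 : (Complex.mk (3 / 4) 0) ∈ U := by
    refine ⟨by simp only [mem_setOf_eq]; norm_num, fun h ↦ ?_⟩
    have := congrArg Complex.re (mem_singleton_iff.1 h)
    norm_num at this
  have hev : rightMellinExt g =ᶠ[𝓝 (Complex.mk (3 / 4) 0)] fun s : ℂ ↦
      c * (a : ℂ) ^ (1 - s) / (1 - s) + mellin ((Ioi a).indicator (g : ℝ → ℂ)) (1 - s) := by
    filter_upwards [hstrip.mem_nhds hmem] with z hz
    rw [hG.2 z hz.1 hz.2, rightMellin_eq_of_ae_eq_const ha (g : ℝ → ℂ) (Lp.memLp g) hgc hz.1 hz.2]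
  exact hGa.eqOn_of_preconnected_of_eventuallyEq hΦa isPreconnected_halfPlane_diff_one hz0 hev
    ⟨hs, hs1⟩

/-- **AM–GM bound for the tail transform**: `‖∫_a^∞ g(t)t^{−s}dt‖ ≤ (∫‖g‖² + a^{1−2σ}/(2σ−1))/2` for
`σ = Re s > 1/2` (`|g|t^{−σ} ≤ (|g|² + t^{−2σ})/2`). [cite: Burnol2004b, proof of Thm. 4.8 ("`G(s)` is `O(A^{Re s})` in `Re s ≥ 1/2+ε`", arXiv:math/0203120v7 p. 10, TeX l.857–858)] -/
theorem norm_mellin_indicator_le {a : ℝ} (ha : 0 < a) (g : Lp ℂ 2 (volume : Measure ℝ)) {s : ℂ}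
    (hs : 1 / 2 < s.re) :
    ‖mellin ((Ioi a).indicator (g : ℝ → ℂ)) (1 - s)‖ ≤
      ((∫ x, ‖(g : ℝ → ℂ) x‖ ^ 2) + a ^ (1 - 2 * s.re) / (2 * s.re - 1)) / 2 := by
  have hsq : Integrable (fun x : ℝ ↦ ‖(g : ℝ → ℂ) x‖ ^ 2) :=
    (memLp_two_iff_integrable_sq_norm (Lp.memLp g).1).1 (Lp.memLp g)
  have hexp : -2 * s.re < -1 := by linarith
  have hpow : IntegrableOn (fun t : ℝ ↦ t ^ (-2 * s.re)) (Ioi a) :=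
    integrableOn_Ioi_rpow_of_lt hexp ha
  have hpow' : Integrable ((Ioi a).indicator fun t : ℝ ↦ t ^ (-2 * s.re)) :=
    hpow.integrable_indicator measurableSet_Ioi
  set m : ℝ → ℝ := fun t ↦ (‖(g : ℝ → ℂ) t‖ ^ 2 + (Ioi a).indicator (fun t : ℝ ↦ t ^ (-2 * s.re)) t) / 2
    with hm
  have hmi : IntegrableOn m (Ioi 0) := ((hsq.add hpow').div_const 2).integrableOn
  have hbd : ∀ᵐ t : ℝ ∂(volume.restrict (Ioi (0 : ℝ))),
      ‖((t : ℝ) : ℂ) ^ ((1 - s) - 1) • (Ioi a).indicator (g : ℝ → ℂ) t‖ ≤ m t := by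
    filter_upwards [ae_restrict_mem measurableSet_Ioi] with t ht
    have ht0 : (0 : ℝ) < t := ht
    rw [hm]
    dsimp only
    by_cases hta : t ∈ Ioi a
    · rw [indicator_of_mem hta, indicator_of_mem hta, norm_smul, norm_cpow_eq_rpow_re_of_pos ht0,
        show ((1 - s) - 1 : ℂ).re = -s.re by simp]
      have h2 : 2 * t ^ (-s.re) * ‖(g : ℝ → ℂ) t‖ ≤ (t ^ (-s.re)) ^ 2 + ‖(g : ℝ → ℂ) t‖ ^ 2 :=
        two_mul_le_add_sq _ _
      have h3 : (t ^ (-s.re)) ^ 2 = t ^ (-2 * s.re) := by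
        rw [← Real.rpow_natCast, ← Real.rpow_mul ht0.le]; norm_num; ring_nf
      rw [h3] at h2
      linarith
    · rw [indicator_of_notMem hta, indicator_of_notMem hta, smul_zero, norm_zero]
      positivity
  calc ‖mellin ((Ioi a).indicator (g : ℝ → ℂ)) (1 - s)‖
      ≤ ∫ t in Ioi 0, m t := norm_integral_le_of_norm_le hmi hbd
    _ = ((∫ t in Ioi 0, ‖(g : ℝ → ℂ) t‖ ^ 2) +
          ∫ t in Ioi 0, (Ioi a).indicator (fun t : ℝ ↦ t ^ (-2 * s.re)) t) / 2 := by
        rw [hm, integral_div, integral_add hsq.integrableOn hpow'.integrableOn]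
    _ ≤ ((∫ x, ‖(g : ℝ → ℂ) x‖ ^ 2) + a ^ (1 - 2 * s.re) / (2 * s.re - 1)) / 2 := by
        have e1 : ∫ t in Ioi 0, (Ioi a).indicator (fun t : ℝ ↦ t ^ (-2 * s.re)) t =
            a ^ (1 - 2 * s.re) / (2 * s.re - 1) := by
          rw [setIntegral_indicator measurableSet_Ioi,
            show Ioi (0 : ℝ) ∩ Ioi a = Ioi a from by rw [inter_eq_right]; exact Ioi_subset_Ioi ha.le,
            integral_Ioi_rpow_of_lt hexp ha, show -2 * s.re + 1 = 1 - 2 * s.re by ring]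
          rw [show (1 - 2 * s.re) = -(2 * s.re - 1) by ring, neg_div, div_neg, neg_neg]
        have e2 : ∫ t in Ioi 0, ‖(g : ℝ → ℂ) t‖ ^ 2 ≤ ∫ x, ‖(g : ℝ → ℂ) x‖ ^ 2 :=
          setIntegral_le_integral hsq (Eventually.of_forall fun u ↦ by positivity)
        rw [e1]
        linarith

/-- **Right half-plane bound** ("`G(s) = O(A^{Re s})` in `Re s ≥ 1/2+ε`, from `ℍ²`"): for `g` as above,
`Re s > 1/2`, `s ≠ 1`: `‖G_g(s)‖ ≤ ‖c‖a^{1−σ}/‖1−s‖ + (∫‖g‖² + a^{1−2σ}/(2σ−1))/2`.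
[cite: Burnol2004b, proof of Thm. 4.8 (arXiv:math/0203120v7 p. 10, TeX l.857–858)] -/
theorem norm_rightMellinExt_le_of_re_gt_half {a : ℝ} (ha : 0 < a)
    {g : Lp ℂ 2 (volume : Measure ℝ)} {c : ℂ} (hgc : ∀ᵐ x : ℝ, x ∈ Ioo 0 a → g x = c)
    (hex : ∃ G, HasRightMellinContinuation g G) {s : ℂ} (hs : 1 / 2 < s.re) (hs1 : s ≠ 1) :
    ‖rightMellinExt g s‖ ≤ ‖c‖ * a ^ (1 - s.re) / ‖1 - s‖ +
      ((∫ x, ‖(g : ℝ → ℂ) x‖ ^ 2) + a ^ (1 - 2 * s.re) / (2 * s.re - 1)) / 2 := by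
  rw [rightMellinExt_eq_polar_add_mellin ha hgc hex hs hs1]
  refine (norm_add_le _ _).trans (add_le_add ?_ (norm_mellin_indicator_le ha g hs))
  rw [norm_div, norm_mul, norm_cpow_eq_rpow_re_of_pos ha, sub_re, one_re]

/-- **Uniform bound on `1/2 + η ≤ Re s ≤ b` away from the pole** (`‖1−s‖ ≥ δ`): there is `C` with
`‖G_g(s)‖ ≤ C` there. [cite: Burnol2004b, proof of Thm. 4.8 (arXiv:math/0203120v7 p. 10, TeX l.857–858)] -/
theorem exists_bound_right {a : ℝ} (ha : 0 < a) {g : Lp ℂ 2 (volume : Measure ℝ)} {c : ℂ}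
    (hgc : ∀ᵐ x : ℝ, x ∈ Ioo 0 a → g x = c) (hex : ∃ G, HasRightMellinContinuation g G)
    {η : ℝ} (hη : 0 < η) (b : ℝ) {δ : ℝ} (hδ : 0 < δ) :
    ∃ C : ℝ, 0 ≤ C ∧ ∀ s : ℂ, 1 / 2 + η ≤ s.re → s.re ≤ b → δ ≤ ‖1 - s‖ →
      ‖rightMellinExt g s‖ ≤ C := by
  set P₁ : ℝ := a ^ (1 - b) + a ^ (1 / 2 - η) with hP₁
  set Q : ℝ := a ^ (1 - 2 * b) + a ^ (-(2 * η)) with hQ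
  set Ig : ℝ := ∫ x, ‖(g : ℝ → ℂ) x‖ ^ 2 with hIg
  have hIg0 : 0 ≤ Ig := integral_nonneg fun u ↦ by positivity
  refine ⟨‖c‖ * P₁ / δ + (Ig + Q / (2 * η)) / 2, by positivity, fun s hs1 hs2 hs3 ↦ ?_⟩
  have hs : 1 / 2 < s.re := by linarith
  have hs0 : s ≠ 1 := by
    intro h
    rw [h, sub_self, norm_zero] at hs3
    linarith
  have h := norm_rightMellinExt_le_of_re_gt_half ha hgc hex hs hs0
  have h1 : ‖c‖ * a ^ (1 - s.re) / ‖1 - s‖ ≤ ‖c‖ * P₁ / δ := by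
    have : a ^ (1 - s.re) ≤ P₁ := rpow_le_rpow_add_rpow ha (by linarith) (by linarith)
    calc ‖c‖ * a ^ (1 - s.re) / ‖1 - s‖ ≤ ‖c‖ * P₁ / ‖1 - s‖ := by gcongr
      _ ≤ ‖c‖ * P₁ / δ := div_le_div_of_nonneg_left (by positivity) hδ hs3
  have h2 : a ^ (1 - 2 * s.re) / (2 * s.re - 1) ≤ Q / (2 * η) := by
    have hQ' : a ^ (1 - 2 * s.re) ≤ Q := rpow_le_rpow_add_rpow ha (by linarith) (by linarith)
    have hQ0 : 0 ≤ Q := by positivity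
    exact div_le_div₀ hQ0 hQ' (by positivity) (by linarith)
  linarith

/-! ### C. The left half-plane through the functional equation -/

/-- **`G_g(s) = χ(s)·G_{𝓕g}(1−s)`, `χ(s) = Γ_ℝ(1−s)/Γ_ℝ(s)`**, for `g ∈ L_a` and `s` off the poles
(`s ∉ −2ℕ`, `s ∉ 1+2ℕ`): Prop. 2.2 (v) applied to `𝓕g ∈ L_a`, with `𝓕𝓕g = g`.
[cite: Burnol2004b, Prop. 2.2 and proof of Thm. 4.8 (arXiv:math/0203120v7 pp. 5, 10; TeX l.460–469, 859–861)] -/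
theorem rightMellinExt_eq_chi_mul {a : ℝ} (ha : 0 < a) {g : Lp ℂ 2 (volume : Measure ℝ)}
    (hg : g ∈ sonineL a) {s : ℂ} (hs0 : ∀ n : ℕ, s ≠ -2 * (n : ℂ))
    (hs1 : ∀ n : ℕ, s ≠ 1 + 2 * (n : ℂ)) :
    rightMellinExt g s = Gammaℝ (1 - s) / Gammaℝ s *
      rightMellinExt (𝓕 g : Lp ℂ 2 (volume : Measure ℝ)) (1 - s) := by
  have hΓ : Gammaℝ s ≠ 0 := by
    rw [Ne, Gammaℝ_eq_zero_iff]
    rintro ⟨n, hn⟩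
    exact hs0 n (by rw [hn]; ring)
  have hFg : (𝓕 g : Lp ℂ 2 (volume : Measure ℝ)) ∈ sonineL a := fourier_mem_sonineL hg
  have hFE := SonineLContinuation.rightMellinExt_functionalEquation_of_mem_sonineL ha hFg s hs0 hs1
  rw [fourier_fourier_eq_self_of_mem_evenL2 hg.1] at hFE
  rw [div_mul_eq_mul_div, eq_div_iff hΓ, mul_comm]
  exact hFE

/-- **Left-strip bound** ("the functional equation on the left", with Titchmarsh (4.12.3)): for
`g ∈ L_a`, `a₀ ≤ Re s ≤ 1/2 − η` and `|Im s| ≥ 1`, `‖G_g(s)‖ ≤ C |Im s|^{1/2 − Re s}`.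
[cite: Burnol2004b, proof of Thm. 4.8 (arXiv:math/0203120v7 p. 10, TeX l.853–861); Titchmarsh1986, §4.12 eq. (4.12.3)] -/
theorem exists_bound_left {a : ℝ} (ha : 0 < a) {g : Lp ℂ 2 (volume : Measure ℝ)}
    (hg : g ∈ sonineL a) {η : ℝ} (hη : 0 < η) (a₀ : ℝ) :
    ∃ C : ℝ, 0 ≤ C ∧ ∀ s : ℂ, a₀ ≤ s.re → s.re ≤ 1 / 2 - η → 1 ≤ |s.im| →
      ‖rightMellinExt g s‖ ≤ C * |s.im| ^ (1 / 2 - s.re) := by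
  obtain ⟨K, hK0, hK⟩ := BurnolScriptL1.exists_norm_Gammaℝ_one_sub_div_le a₀ (1 / 2 - η)
  have hFg : (𝓕 g : Lp ℂ 2 (volume : Measure ℝ)) ∈ sonineL a := fourier_mem_sonineL hg
  obtain ⟨c', hc'⟩ := hFg.2.1
  have hexF : ∃ G, HasRightMellinContinuation (𝓕 g : Lp ℂ 2 (volume : Measure ℝ)) G :=
    ⟨_, hasRightMellinContinuation_rightMellinExt_of_mem_sonineL ha hFg⟩
  obtain ⟨C, hC0, hC⟩ := exists_bound_right ha hc' hexF hη (1 - a₀) one_pos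
  refine ⟨K * C, by positivity, fun s hsa hsb hst ↦ ?_⟩
  have ht0 : 0 < |s.im| := by linarith
  have him : s.im ≠ 0 := abs_pos.mp ht0
  have hs0 : ∀ n : ℕ, s ≠ -2 * (n : ℂ) := by
    intro n h; apply him; rw [h]; simp
  have hs1 : ∀ n : ℕ, s ≠ 1 + 2 * (n : ℂ) := by
    intro n h; apply him; rw [h]; simp
  rw [rightMellinExt_eq_chi_mul ha hg hs0 hs1, norm_mul]
  have h1 := hK s hsa hsb hst
  have h2 : ‖rightMellinExt (𝓕 g : Lp ℂ 2 (volume : Measure ℝ)) (1 - s)‖ ≤ C := by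
    refine hC (1 - s) (by simp; linarith) (by simp; linarith) ?_
    rw [sub_sub_cancel]
    exact hst.trans (Complex.abs_im_le_norm s)
  calc ‖Gammaℝ (1 - s) / Gammaℝ s‖ * ‖rightMellinExt (𝓕 g : Lp ℂ 2 (volume : Measure ℝ)) (1 - s)‖
      ≤ (K * |s.im| ^ (1 / 2 - s.re)) * C := mul_le_mul h1 h2 (norm_nonneg _) (by positivity)
    _ = K * C * |s.im| ^ (1 / 2 - s.re) := by ring

/-! ### D. The middle strip `|Re s − 1/2| ≤ η`: Phragmén–Lindelöf -/

/-- `‖z‖ ≤ 1 + |Im z|` when `|Re z| ≤ 1`. [folklore] -/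
private theorem norm_le_one_add_abs_im {z : ℂ} (hz : |z.re| ≤ 1) : ‖z‖ ≤ 1 + |z.im| :=
  (Complex.norm_le_abs_re_add_abs_im z).trans (by linarith)

/-- **Lindelöf in the middle strip.** For `g ∈ L_a` and `0 < η ≤ 1/4`:
`‖G_g(s)‖ ≤ C(1+|Im s|)^η` on `1/2 − η ≤ Re s ≤ 1/2 + η`. Printed: "one applies the
Phragmén–Lindelöf principle in the strip" with the a priori bound `G(s) = O(|s|)` there, the bound
`O(A^{Re s})` on the right line and `O(|Im s|^{η})` (functional equation + (4.12.3)) on the left line.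
Here: Mathlib's `PhragmenLindelof.vertical_strip` for `F(s) = G_g(s)(s+1)^{−η}`.
[cite: Burnol2004b, proof of Thm. 4.8 (arXiv:math/0203120v7 p. 10, TeX l.851–884); Titchmarsh1986, §5.65] -/
theorem exists_bound_middle {a : ℝ} (ha : 0 < a) {g : Lp ℂ 2 (volume : Measure ℝ)}
    (hg : g ∈ sonineL a) {η : ℝ} (hη : 0 < η) (hη4 : η ≤ 1 / 4) :
    ∃ C : ℝ, 0 ≤ C ∧ ∀ s : ℂ, 1 / 2 - η ≤ s.re → s.re ≤ 1 / 2 + η →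
      ‖rightMellinExt g s‖ ≤ C * (1 + |s.im|) ^ η := by
  set G : ℂ → ℂ := rightMellinExt g with hGdef
  have hcont := hasRightMellinContinuation_rightMellinExt_of_mem_sonineL ha hg
  have hhol : DifferentiableOn ℂ G {s | s ≠ 1} := hcont.1
  obtain ⟨c, hgc⟩ := hg.2.1
  have hex : ∃ G', HasRightMellinContinuation g G' := ⟨_, hcont⟩
  -- the right edge
  obtain ⟨CR, hCR0, hCR⟩ := exists_bound_right ha hgc hex hη (1 / 2 + η) (δ := 1 / 2 - η) (by linarith)
  -- the left edge, far part
  obtain ⟨CL, hCL0, hCL⟩ := exists_bound_left ha hg hη (1 / 2 - η)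
  -- the left edge, compact part
  set seg : Set ℂ := (fun τ : ℝ ↦ (((1 / 2 - η : ℝ)) : ℂ) + τ * I) '' Icc (-1) 1 with hseg
  have hsegc : IsCompact seg := isCompact_Icc.image (by fun_prop)
  have hseg1 : seg ⊆ {s : ℂ | s ≠ 1} := by
    rintro z ⟨τ, -, rfl⟩ h
    have := congrArg Complex.re h
    simp at this
    linarith
  obtain ⟨M₀, hM₀⟩ := hsegc.exists_bound_of_continuousOn (hhol.continuousOn.mono hseg1)
  -- the a priori bound
  obtain ⟨M, hM0, hM⟩ := exists_bound_strip_of_mem_sonineL ha hg (σ₁ := 1 / 2 - η) (σ₂ := 1 / 2 + η)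
    (by linarith) (by linarith)
  -- the auxiliary function
  set F : ℂ → ℂ := fun z ↦ G z * (z + 1) ^ (((-η : ℝ)) : ℂ) with hFdef
  have hnF : ∀ z : ℂ, ‖F z‖ = ‖G z‖ * ‖z + 1‖ ^ (-η) := by
    intro z; rw [hFdef]; dsimp only; rw [norm_mul, Complex.norm_cpow_real]
  have hz1 : ∀ z : ℂ, 1 / 2 - η ≤ z.re → 1 ≤ ‖z + 1‖ := by
    intro z hz
    calc (1 : ℝ) ≤ |(z + 1).re| := by rw [add_re, one_re, abs_of_pos (by linarith)]; linarith
      _ ≤ ‖z + 1‖ := Complex.abs_re_le_norm _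
  have hpow1 : ∀ z : ℂ, 1 / 2 - η ≤ z.re → ‖z + 1‖ ^ (-η) ≤ 1 := fun z hz ↦
    Real.rpow_le_one_of_one_le_of_nonpos (hz1 z hz) (by linarith)
  set C₀ : ℝ := CR + CL + max M₀ 0 with hC₀
  -- (1) differentiability on the closed strip
  have hdiff : DiffContOnCl ℂ F (re ⁻¹' Ioo (1 / 2 - η) (1 / 2 + η)) := by
    apply DifferentiableOn.diffContOnCl
    have hcl : closure (re ⁻¹' Ioo (1 / 2 - η) (1 / 2 + η)) ⊆ re ⁻¹' Icc (1 / 2 - η) (1 / 2 + η) := by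
      have h := Complex.continuous_re.closure_preimage_subset (Ioo (1 / 2 - η) (1 / 2 + η))
      rwa [closure_Ioo (by linarith : (1 / 2 - η : ℝ) ≠ 1 / 2 + η)] at h
    refine DifferentiableOn.mono (fun z hz ↦ ?_) hcl
    have hz' : 1 / 2 - η ≤ z.re ∧ z.re ≤ 1 / 2 + η := hz
    have hzne : z ≠ 1 := by
      intro h; rw [h, one_re] at hz'; linarith
    have hGz : DifferentiableAt ℂ G z := hhol.differentiableAt (isOpen_ne.mem_nhds hzne)
    have hslit : z + 1 ∈ slitPlane := by
      rw [mem_slitPlane_iff]; left; rw [add_re, one_re]; linarith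
    exact (hGz.mul ((differentiableAt_id.add_const (1 : ℂ)).cpow_const hslit)).differentiableWithinAt
  -- (2) the a priori growth bound
  have hB : ∃ c < π / (1 / 2 + η - (1 / 2 - η)), ∃ B,
      F =O[comap (_root_.abs ∘ im) atTop ⊓ 𝓟 (re ⁻¹' Ioo (1 / 2 - η) (1 / 2 + η))]
        fun z ↦ Real.exp (B * Real.exp (c * |z.im|)) := by
    refine ⟨1, ?_, 2, ?_⟩
    · rw [lt_div_iff₀ (by linarith)]
      nlinarith [Real.pi_gt_three]
    refine IsBigO.of_bound (M * Real.exp 2) (eventually_inf_principal.2 (Eventually.of_forall ?_))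
    intro z hz
    have hz' : 1 / 2 - η < z.re ∧ z.re < 1 / 2 + η := hz
    have hre : |z.re| ≤ 1 := by rw [abs_le]; constructor <;> linarith
    have hn := norm_le_one_add_abs_im hre
    rw [Real.norm_of_nonneg (Real.exp_pos _).le, hnF, one_mul]
    have e1 : (1 + ‖z‖) ^ 2 ≤ Real.exp (2 + 2 * |z.im|) := by
      have h1 : 1 + ‖z‖ ≤ Real.exp (1 + |z.im|) := by
        have := Real.add_one_le_exp (1 + |z.im|); linarith
      calc (1 + ‖z‖) ^ 2 ≤ (Real.exp (1 + |z.im|)) ^ 2 := by gcongr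
        _ = Real.exp (2 + 2 * |z.im|) := by rw [← Real.exp_nat_mul]; ring_nf
    have e2 : Real.exp (2 + 2 * |z.im|) ≤ Real.exp 2 * Real.exp (2 * Real.exp |z.im|) := by
      rw [← Real.exp_add, Real.exp_le_exp]
      have := Real.add_one_le_exp |z.im|
      linarith
    calc ‖G z‖ * ‖z + 1‖ ^ (-η) ≤ M * (1 + ‖z‖) ^ 2 * 1 :=
          mul_le_mul (hM z hz'.1.le hz'.2.le) (hpow1 z hz'.1.le) (by positivity) (by positivity)
      _ ≤ M * (Real.exp 2 * Real.exp (2 * Real.exp |z.im|)) := by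
          rw [mul_one]; exact mul_le_mul_of_nonneg_left (e1.trans e2) hM0
      _ = M * Real.exp 2 * Real.exp (2 * Real.exp |z.im|) := by ring
  -- (3) the two edges
  have hleft : ∀ z : ℂ, z.re = 1 / 2 - η → ‖F z‖ ≤ C₀ := by
    intro z hz
    rw [hnF]
    rcases le_or_gt 1 |z.im| with him | him
    · have h1 := hCL z hz.ge hz.le him
      rw [hz, show (1 / 2 - (1 / 2 - η) : ℝ) = η by ring] at h1
      have him0 : 0 < |z.im| := by linarith
      have h2 : ‖z + 1‖ ^ (-η) ≤ |z.im| ^ (-η) := by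
        refine Real.rpow_le_rpow_of_nonpos him0 ?_ (by linarith)
        calc |z.im| = |(z + 1).im| := by simp
          _ ≤ ‖z + 1‖ := Complex.abs_im_le_norm _
      calc ‖G z‖ * ‖z + 1‖ ^ (-η) ≤ (CL * |z.im| ^ η) * |z.im| ^ (-η) :=
            mul_le_mul h1 h2 (by positivity) (by positivity)
        _ = CL := by
            rw [Real.rpow_neg him0.le, mul_assoc, mul_inv_cancel₀ (Real.rpow_pos_of_pos him0 _).ne',
              mul_one]
        _ ≤ C₀ := by rw [hC₀]; linarith [le_max_right M₀ 0]
    · have hzseg : z ∈ seg := by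
        refine ⟨z.im, ⟨by linarith [neg_abs_le z.im], by linarith [le_abs_self z.im]⟩, ?_⟩
        apply Complex.ext <;> simp [hz]
      have h1 := hM₀ z hzseg
      calc ‖G z‖ * ‖z + 1‖ ^ (-η) ≤ max M₀ 0 * 1 :=
            mul_le_mul (h1.trans (le_max_left _ _)) (hpow1 z hz.ge) (by positivity) (by positivity)
        _ ≤ C₀ := by rw [hC₀, mul_one]; linarith
  have hright : ∀ z : ℂ, z.re = 1 / 2 + η → ‖F z‖ ≤ C₀ := by
    intro z hz
    rw [hnF]
    have h1 : ‖G z‖ ≤ CR := by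
      refine hCR z hz.ge hz.le ?_
      calc 1 / 2 - η = |(1 - z).re| := by rw [sub_re, one_re, hz, abs_of_pos (by linarith)]; ring
        _ ≤ ‖1 - z‖ := Complex.abs_re_le_norm _
    calc ‖G z‖ * ‖z + 1‖ ^ (-η) ≤ CR * 1 :=
          mul_le_mul h1 (hpow1 z (by linarith)) (by positivity) hCR0
      _ ≤ C₀ := by rw [hC₀, mul_one]; linarith [le_max_right M₀ 0]
  -- (4) Phragmén–Lindelöf and the conclusion
  refine ⟨2 * C₀, by positivity, fun s hs1 hs2 ↦ ?_⟩
  have hPL : ‖F s‖ ≤ C₀ := PhragmenLindelof.vertical_strip hdiff hB hleft hright hs1 hs2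
  have hn1 : 0 < ‖s + 1‖ := lt_of_lt_of_le one_pos (hz1 s hs1)
  have hGF : ‖G s‖ = ‖F s‖ * ‖s + 1‖ ^ η := by
    rw [hnF, Real.rpow_neg hn1.le, mul_assoc, inv_mul_cancel₀ (Real.rpow_pos_of_pos hn1 _).ne',
      mul_one]
  have hre : |s.re| ≤ 1 := by rw [abs_le]; constructor <;> linarith
  have hs1' : ‖s + 1‖ ≤ 2 * (1 + |s.im|) := by
    calc ‖s + 1‖ ≤ ‖s‖ + ‖(1 : ℂ)‖ := norm_add_le _ _
      _ ≤ (1 + |s.im|) + 1 := by rw [norm_one]; linarith [norm_le_one_add_abs_im hre]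
      _ ≤ 2 * (1 + |s.im|) := by linarith [abs_nonneg s.im]
  have hpow : ‖s + 1‖ ^ η ≤ 2 * (1 + |s.im|) ^ η := by
    calc ‖s + 1‖ ^ η ≤ (2 * (1 + |s.im|)) ^ η := Real.rpow_le_rpow (norm_nonneg _) hs1' hη.le
      _ = 2 ^ η * (1 + |s.im|) ^ η := Real.mul_rpow (by norm_num) (by positivity)
      _ ≤ 2 * (1 + |s.im|) ^ η := by
          gcongr
          calc (2 : ℝ) ^ η ≤ 2 ^ (1 : ℝ) := Real.rpow_le_rpow_of_exponent_le (by norm_num) (by linarith)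
            _ = 2 := Real.rpow_one 2
  have hC₀0 : 0 ≤ C₀ := by positivity
  rw [hGF]
  calc ‖F s‖ * ‖s + 1‖ ^ η ≤ C₀ * (2 * (1 + |s.im|) ^ η) :=
        mul_le_mul hPL hpow (by positivity) hC₀0
    _ = 2 * C₀ * (1 + |s.im|) ^ η := by ring

end BurnolLProperty

/-! ### Thm. 4.8 -/

open BurnolLProperty in
/-- **Burnol 2004b, Thm. 4.8, PROVED: "The functions in `L̂_a` have the L-Property"** — discharge of the
named fact `Burnol2004b_thm4_8` (typed: for `a > 0`, `g ∈ L_a`, `HasLProperty (rightMellinExt g)`: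
on every strip `a' ≤ σ ≤ b'`, every `ε > 0`, beyond some height,
`‖G_g(σ+iτ)‖ ≤ C(1+|τ|)^{max(1/2−a',0)+ε}`). The printed proof is followed: `O(A^{Re s})` (here: a
constant) on `Re s ≥ 1/2 + η` from the `ℍ²`/Cauchy–Schwarz structure of
`f̂(s) = c·a^{1−s}/(1−s) + ∫_a^∞ f t^{−s}`; `O(|Im s|^{1/2−σ})` on `Re s ≤ 1/2 − η` from the functional
equation and `|χ(s)| ≍ |Im s|^{1/2−Re s}` (Titchmarsh (4.12.3)); the a priori bound `G(s) = O(|s|)` in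
the critical strip from the series (1.3) of [Burnol2001CRAS]; and the Phragmén–Lindelöf principle in
the strip `|Re s − 1/2| ≤ η`, `η = min(ε, 1/4)`.
[cite: Burnol2004b, Thm. 4.8 (arXiv:math/0203120v7 p. 9, TeX l.831–884)] -/
theorem Burnol2004b_thm4_8_holds : Burnol2004b_thm4_8 := by
  intro a ha g hg A B ε _ hε
  set η : ℝ := min ε (1 / 4) with hη
  have hη0 : 0 < η := lt_min hε (by norm_num)
  have hηε : η ≤ ε := min_le_left _ _
  have hη4 : η ≤ 1 / 4 := min_le_right _ _
  obtain ⟨c, hgc⟩ := hg.2.1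
  have hex : ∃ G', HasRightMellinContinuation g G' :=
    ⟨_, hasRightMellinContinuation_rightMellinExt_of_mem_sonineL ha hg⟩
  obtain ⟨C₁, hC₁0, hC₁⟩ := exists_bound_right ha hgc hex hη0 (max B 1) one_pos
  obtain ⟨C₂, hC₂0, hC₂⟩ := exists_bound_left ha hg hη0 A
  obtain ⟨C₃, hC₃0, hC₃⟩ := exists_bound_middle ha hg hη0 hη4
  refine ⟨C₁ + C₂ + C₃, 1, fun σ τ hσA hσB hτ ↦ ?_⟩
  set s : ℂ := (σ : ℂ) + τ * I with hs
  have hsre : s.re = σ := by simp [hs]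
  have hsim : s.im = τ := by simp [hs]
  set e : ℝ := max (1 / 2 - A) 0 + ε with he
  have hbase : (1 : ℝ) ≤ 1 + |τ| := by linarith [abs_nonneg τ]
  have hone : (1 : ℝ) ≤ (1 + |τ|) ^ e := Real.one_le_rpow hbase (by positivity)
  have hC0 : 0 ≤ C₁ + C₂ + C₃ := by positivity
  rcases le_or_gt (1 / 2 + η) σ with h1 | h1
  · -- right region: bounded
    have hb : ‖rightMellinExt g s‖ ≤ C₁ := by
      refine hC₁ s (by rw [hsre]; exact h1) (by rw [hsre]; exact hσB.trans (le_max_left _ _)) ?_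
      calc (1 : ℝ) ≤ |τ| := hτ
        _ = |(1 - s).im| := by simp [hsim]
        _ ≤ ‖1 - s‖ := Complex.abs_im_le_norm _
    calc ‖rightMellinExt g s‖ ≤ C₁ * 1 := by rw [mul_one]; exact hb
      _ ≤ (C₁ + C₂ + C₃) * (1 + |τ|) ^ e := mul_le_mul (by linarith) hone zero_le_one hC0
  rcases le_or_gt σ (1 / 2 - η) with h2 | h2
  · -- left region: `O(|τ|^{1/2−σ})`
    have hb : ‖rightMellinExt g s‖ ≤ C₂ * |τ| ^ (1 / 2 - σ) := by
      have := hC₂ s (by rw [hsre]; exact hσA) (by rw [hsre]; exact h2) (by rw [hsim]; exact hτ)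
      rwa [hsre, hsim] at this
    have hexp : |τ| ^ (1 / 2 - σ) ≤ (1 + |τ|) ^ e :=
      calc |τ| ^ (1 / 2 - σ) ≤ (1 + |τ|) ^ (1 / 2 - σ) :=
            Real.rpow_le_rpow (abs_nonneg τ) (by linarith) (by linarith)
        _ ≤ (1 + |τ|) ^ e := by
            refine Real.rpow_le_rpow_of_exponent_le hbase ?_
            rw [he]
            linarith [le_max_left (1 / 2 - A) 0]
    calc ‖rightMellinExt g s‖ ≤ C₂ * |τ| ^ (1 / 2 - σ) := hb
      _ ≤ (C₁ + C₂ + C₃) * (1 + |τ|) ^ e := mul_le_mul (by linarith) hexp (by positivity) hC0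
  · -- middle strip: Phragmén–Lindelöf
    have hb : ‖rightMellinExt g s‖ ≤ C₃ * (1 + |τ|) ^ η := by
      have := hC₃ s (by rw [hsre]; exact h2.le) (by rw [hsre]; exact h1.le)
      rwa [hsim] at this
    have hexp : (1 + |τ|) ^ η ≤ (1 + |τ|) ^ e := by
      refine Real.rpow_le_rpow_of_exponent_le hbase ?_
      rw [he]
      linarith [le_max_right (1 / 2 - A) 0]
    calc ‖rightMellinExt g s‖ ≤ C₃ * (1 + |τ|) ^ η := hb
      _ ≤ (C₁ + C₂ + C₃) * (1 + |τ|) ^ e := mul_le_mul (by linarith) hexp (by positivity) hC0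

end Literature.NumberTheory.LFunctions

end
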